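import Summits.HubbardSuperconductivity.HubbardSuperconductivity.Theorems.WidthHaldaneTubeBlochBound
import Summits.HubbardSuperconductivity.HubbardSuperconductivity.Theorems.WidthHaldaneTubeTwoCut
import Literature.MathematicalPhysics.QuantumLattice.HubbardTorusFluxThermalBlochBound

/-!
# The thermal Bloch bound on the Hubbard tube, on every coordinate sector

Support file for crux `WidthUniformThermodynamics` (stmt-HubbardSuperconductivity-16312; routes
`WidthHaldane`, `SeamInduction`). The crux idea
`Cruxes/WidthUniformThermodynamics/Ideas/euclidean-helicity-descent.md` (2026-08-17 round) works
with canonical sector partition functions of the twisted tube `H₀ + Tw_θ` at a mesoscopic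
`β = C·L` (landed handles: `Theorems/WidthHaldaneTubeHelicityDescent.lean`,
`…TubeHelicityCriterion.lean`) and lists as "provable-now companions to be filed as support" the
THERMAL TWINS of the landed flux kinematics (`tubeEnergy_le_tubeEnergy_zero_add`,
`tubeEnergy_neg`, `tubeEnergy_add_two_pi`): the thermal Bloch bound `F_β(θ) ≤ F_β(0) + θ²M/L`,
evenness and `2π`-periodicity of `Z_β` in the flux. This file PROVES them (no definition, no named
fact) in the block vocabulary of `Literature/…/HubbardTorusFluxThermalBlochBound`
(`Matrix.partitionFn` of the compressions `Matrix.toBlock p p` to EVERY coordinate predicate `p`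
on occupation sets; every joint sector `(N↑, N↓)` is such a block — the dictionary to the
projector vocabulary `tr (P_K e^{-βH})` of the helicity files is
`Theorems/WidthHaldaneTubeSectorPartitionBlock.lean`):

* `partitionFn_toBlock_phaseGauge_conj` — gauge invariance of every block partition function under
  the diagonal unitaries `phaseGauge g` (they commute with the compression);
* `re_partitionFn_toBlock_tubeH_neg`, `partitionFn_toBlock_tubeH_add_two_pi` — `Re Z_β` is EVEN
  and `2π`-PERIODIC in the flux on every block (time reversal `tubeH_map_conj`;
  `tubeTwist_add_two_pi`);
* `re_expect_gauged_add_gauged_neg_le`, **`posSemidef_tubeH0_add_sub_half_gauged`** — the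
  operator Bloch estimate `H₀ + θ²M/L - ½(G_θ + G_{-θ}) ≥ 0`, `G_θ = W_θ (H₀ + Tw_θ) W_θᴴ` the
  uniformly gauged twisted tube (`re_expect_gauged_tubeH`, `summand_pm_le`, `sum_weight_eq` of
  `WidthHaldaneTubeBlochBound`, extended from unit vectors by homogeneity);
* **`exp_mul_re_partitionFn_toBlock_tubeH0_le`** / `thermalBlochBlock` (closed form, the
  registered sub-goal) — THE THERMAL BLOCH BOUND (`L ≥ 3`, `β ≥ 0`, every `p`):
  `e^{-βθ²M/L} Re Z_β(H₀|_p) ≤ Re Z_β((H₀ + Tw_θ)|_p)` — Peierls–Bogoliubov twice at the midpoint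
  (`log_partitionFn_sub_le_log_partitionFn_add`), time reversal, and the operator estimate
  compressed to the block, exactly as in the Literature torus file; with the logarithmic and
  free-energy forms `log_partitionFn_toBlock_tubeH0_sub_le`, **`freeEnergy_toBlock_tubeH_le`**:
  `F_p(θ) ≤ F_p(0) + θ²M/L` for `β > 0` on every non-empty block — the helicity modulus of the
  tube at ANY temperature obeys the same `O(M/L)` ceiling as the `T = 0` flux cost (so the ★
  helicity-floor constant of the card is a priori `≤ 9/π²`-sized, consistent with
  `tubeStiffness_le_two`).

References: D. Bohm, Phys. Rev. 75 (1949) 502; N. Byers, C. N. Yang, PRL 7 (1961) 46;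
H. Watanabe, J. Stat. Phys. 177 (2019) 717, §2.2, §4.1; E. L. Pollock, D. M. Ceperley, PRB 36 (1987)
8343; O. Bratteli, D. W. Robinson, *Operator Algebras and Quantum Statistical Mechanics II* §5.3.1.
-/

noncomputable section

namespace Summit.HubbardSuperconductivity.HubbardSuperconductivity.Theorems.WidthHaldane

set_option linter.dupNamespace false -- summit = problem name (single-conjunct summit), D-0017

open scoped BigOperators Classical Matrix ComplexConjugate
open Matrix Literature.MathematicalPhysics.QuantumLattice

/-! ### Gauge invariance, time reversal and flux periodicity of the block partition functions -/

section Symmetries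

variable (L M : ℕ) [NeZero L] [NeZero M] (Λ : Type) [LinearOrder Λ] [Fintype Λ]
  (e : Λ ≃ ZMod L × ZMod M)

omit [NeZero L] [NeZero M] in
/-- **Gauge invariance of every block partition function**: conjugating by the diagonal unitary
`phaseGauge g` does not change `Z_β` on any coordinate block (the gauge commutes with the
compression). [cite: Watanabe2019, §2.2.3 and §4.1] -/
theorem partitionFn_toBlock_phaseGauge_conj (g : Λ → Circle) (β : ℝ)
    (H : Matrix (Finset (Orb Λ)) (Finset (Orb Λ)) ℂ)
    (p : Finset (Orb Λ) → Prop) [Fintype {a // p a}] [DecidableEq {a // p a}] :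
    partitionFn β ((phaseGauge g * H * (phaseGauge g)ᴴ).toBlock p p) = partitionFn β (H.toBlock p p) := by
  have hunit : ∀ z : Circle, star (z : ℂ) * (z : ℂ) = 1 := fun z => by
    rw [Complex.star_def, ← Complex.normSq_eq_conj_mul_self, Circle.normSq_coe, Complex.ofReal_one]
  rw [phaseGauge_eq, conjTranspose_diagonal_inst, toBlock_diagonal_mul_mul_diagonal]
  have h := partitionFn_diagonal_star_mul_mul_diagonal
    (fun a : {a // p a} => star (((∏ o ∈ a.1, g (ofLex o).1 : Circle) : ℂ)))
    (fun a => by rw [star_star, mul_comm]; exact hunit _) β (H.toBlock p p)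
  simpa only [star_star] using h

/-- **Time reversal on a block**: `Re Z_β((H₀ + Tw_{-θ})|_p) = Re Z_β((H₀ + Tw_θ)|_p)` — entrywise
complex conjugation reverses the flux (`tubeH_map_conj`), commutes with the compression and
conjugates `Z`. [cite: ByersYang1961, p. 46] -/
theorem re_partitionFn_toBlock_tubeH_neg (U θ β : ℝ)
    (p : Finset (Orb Λ) → Prop) [Fintype {a // p a}] [DecidableEq {a // p a}] :
    (partitionFn β ((tubeH0 L M Λ e U + tubeTwist L M Λ e (-θ)).toBlock p p)).re =
      (partitionFn β ((tubeH0 L M Λ e U + tubeTwist L M Λ e θ).toBlock p p)).re := by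
  rw [← tubeH_map_conj, toBlock_map, partitionFn_map_starRingEnd, Complex.conj_re]

/-- **Flux quantum on every block**: `Z_β((H₀ + Tw_{θ+2π})|_p) = Z_β((H₀ + Tw_θ)|_p)`.
[cite: ByersYang1961, p. 46] -/
theorem partitionFn_toBlock_tubeH_add_two_pi (U θ β : ℝ)
    (p : Finset (Orb Λ) → Prop) [Fintype {a // p a}] [DecidableEq {a // p a}] :
    partitionFn β ((tubeH0 L M Λ e U + tubeTwist L M Λ e (θ + 2 * Real.pi)).toBlock p p) =
      partitionFn β ((tubeH0 L M Λ e U + tubeTwist L M Λ e θ).toBlock p p) := by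
  rw [tubeTwist_add_two_pi]

end Symmetries

/-! ### The operator Bloch estimate for the uniformly gauged twisted tube -/

section OperatorBloch

variable (L M : ℕ) [NeZero L] [NeZero M] (Λ : Type) [LinearOrder Λ] [Fintype Λ]
  (e : Λ ≃ ZMod L × ZMod M)

omit [NeZero L] [NeZero M] [LinearOrder Λ] [Fintype Λ] in
/-- Quadratic forms are homogeneous of degree two: `Re⟨cψ, A cψ⟩ = |c|² Re⟨ψ, Aψ⟩`. [folklore] -/
theorem re_star_smul_dotProduct_mulVec_smul {n : Type*} [Fintype n] (A : Matrix n n ℂ) (c : ℂ)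
    (ψ : n → ℂ) :
    (star (c • ψ) ⬝ᵥ (A *ᵥ (c • ψ))).re = Complex.normSq c * (star ψ ⬝ᵥ (A *ᵥ ψ)).re := by
  rw [star_smul, mulVec_smul, dotProduct_smul, smul_dotProduct, smul_smul, smul_eq_mul,
    Complex.star_def, Complex.mul_conj, Complex.re_ofReal_mul]

omit [NeZero L] [NeZero M] [LinearOrder Λ] [Fintype Λ] in
/-- `Re⟨cψ, cψ⟩ = |c|² Re⟨ψ, ψ⟩`. [folklore] -/
theorem re_star_smul_dotProduct_smul {n : Type*} [Fintype n] (c : ℂ) (ψ : n → ℂ) :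
    (star (c • ψ) ⬝ᵥ (c • ψ)).re = Complex.normSq c * (star ψ ⬝ᵥ ψ).re := by
  rw [star_smul, dotProduct_smul, smul_dotProduct, smul_smul, smul_eq_mul,
    Complex.star_def, Complex.mul_conj, Complex.re_ofReal_mul]

/-- **The two flux orientations together cost at most `2θ²M/L` on a unit vector** (`L ≥ 3`): with
`G_θ = W_θ (H₀ + Tw_θ) W_θᴴ` the uniformly gauged twisted tube,
`Re⟨ψ, G_θ ψ⟩ + Re⟨ψ, G_{-θ} ψ⟩ ≤ 2Re⟨ψ, H₀ψ⟩ + 2θ²M/L` for every unit Fock vector `ψ` — the bond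
currents cancel between `± θ` and each of the `2LM` longitudinal ordered hops pays at most
`(2 - 2cos(θ/L))/2 ≤ θ²/(2L²)` (`summand_pm_le`, `sum_weight_eq`).
[cite: Watanabe2019, §2.2.3 and §4.1] -/
theorem re_expect_gauged_add_gauged_neg_le (hL : 3 ≤ L) (U θ : ℝ) {ψ : Fock (Orb Λ)}
    (h1 : star ψ ⬝ᵥ ψ = 1) :
    (expect (phaseGauge (fun z : Λ => Circle.exp (θ / L * ((e z).1.val : ℝ))) *
        (tubeH0 L M Λ e U + tubeTwist L M Λ e θ) *
        (phaseGauge (fun z : Λ => Circle.exp (θ / L * ((e z).1.val : ℝ))))ᴴ) ψ).re +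
      (expect (phaseGauge (fun z : Λ => Circle.exp ((-θ) / L * ((e z).1.val : ℝ))) *
        (tubeH0 L M Λ e U + tubeTwist L M Λ e (-θ)) *
        (phaseGauge (fun z : Λ => Circle.exp ((-θ) / L * ((e z).1.val : ℝ))))ᴴ) ψ).re ≤
      2 * (expect (tubeH0 L M Λ e U) ψ).re + 2 * (θ ^ 2 * M / L) := by
  rw [re_expect_gauged_tubeH L M Λ e hL U θ ψ, re_expect_gauged_tubeH L M Λ e hL U (-θ) ψ,
    add_add_add_comm, ← two_mul, add_le_add_iff_left]
  rw [← Finset.sum_add_distrib]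
  calc _ ≤ ∑ x : Λ, ∑ y : Λ, ∑ _σ : Fin 2, (2 - 2 * Real.cos (θ / L)) *
        ((if y = e.symm ((e x).1 + 1, (e x).2) then 1 / 2 else 0) +
          (if y = e.symm ((e x).1 - 1, (e x).2) then 1 / 2 else 0)) := by
        refine Finset.sum_le_sum fun x _ => ?_
        rw [← Finset.sum_add_distrib]
        refine Finset.sum_le_sum fun y _ => ?_
        rw [← Finset.sum_add_distrib]
        refine Finset.sum_le_sum fun σ _ => ?_
        exact summand_pm_le L M Λ e θ x y _ (fun hxy =>
          abs_re_star_dotProduct_creation_mul_annihilation_mulVec_le_half h1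
            (fun h => hxy (congrArg (fun o : Orb Λ => (ofLex o).1) h)))
    _ = (2 - 2 * Real.cos (θ / L)) * (2 * ((L : ℝ) * M)) := sum_weight_eq L M Λ e θ
    _ ≤ (θ / L) ^ 2 * (2 * ((L : ℝ) * M)) := by
        have := two_sub_two_mul_cos_le_sq (θ / L)
        have h0 : 0 ≤ 2 * ((L : ℝ) * M) := by positivity
        nlinarith
    _ = 2 * (θ ^ 2 * M / L) := by
        have hL0 : (L : ℝ) ≠ 0 := by exact_mod_cast (NeZero.ne L)
        field_simp

open scoped ComplexOrder in
/-- **The operator Bloch estimate** (`L ≥ 3`): `H₀ + θ²M/L - ½(G_θ + G_{-θ}) ≥ 0` as matrices on the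
Fock space, `G_θ = W_θ (H₀ + Tw_θ) W_θᴴ` — the quadratic-form version of
`re_expect_gauged_add_gauged_neg_le`, extended from unit vectors by homogeneity.
[cite: Watanabe2019, §2.2.1 eqs. (13)–(16)] -/
theorem posSemidef_tubeH0_add_sub_half_gauged (hL : 3 ≤ L) (U θ : ℝ) :
    (tubeH0 L M Λ e U + ((θ ^ 2 * M / L : ℝ) : ℂ) •
        (1 : Matrix (Finset (Orb Λ)) (Finset (Orb Λ)) ℂ) -
      ((1 / 2 : ℝ) : ℂ) •
        (phaseGauge (fun z : Λ => Circle.exp (θ / L * ((e z).1.val : ℝ))) *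
            (tubeH0 L M Λ e U + tubeTwist L M Λ e θ) *
            (phaseGauge (fun z : Λ => Circle.exp (θ / L * ((e z).1.val : ℝ))))ᴴ +
          phaseGauge (fun z : Λ => Circle.exp ((-θ) / L * ((e z).1.val : ℝ))) *
            (tubeH0 L M Λ e U + tubeTwist L M Λ e (-θ)) *
            (phaseGauge (fun z : Λ => Circle.exp ((-θ) / L * ((e z).1.val : ℝ))))ᴴ)).PosSemidef := by
  set H0 := tubeH0 L M Λ e U with hH0def
  set Gp := phaseGauge (fun z : Λ => Circle.exp (θ / L * ((e z).1.val : ℝ))) *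
      (tubeH0 L M Λ e U + tubeTwist L M Λ e θ) *
      (phaseGauge (fun z : Λ => Circle.exp (θ / L * ((e z).1.val : ℝ))))ᴴ with hGpdef
  set Gm := phaseGauge (fun z : Λ => Circle.exp ((-θ) / L * ((e z).1.val : ℝ))) *
      (tubeH0 L M Λ e U + tubeTwist L M Λ e (-θ)) *
      (phaseGauge (fun z : Λ => Circle.exp ((-θ) / L * ((e z).1.val : ℝ))))ᴴ with hGmdef
  set c : ℝ := θ ^ 2 * M / L with hc
  have hH0 : H0.IsHermitian := isHermitian_tubeH0 L M Λ e U
  have hGp : Gp.IsHermitian := Matrix.isHermitian_mul_mul_conjTranspose _ (isHermitian_tubeH L M Λ e U θ)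
  have hGm : Gm.IsHermitian :=
    Matrix.isHermitian_mul_mul_conjTranspose _ (isHermitian_tubeH L M Λ e U (-θ))
  have hE : (H0 + ((c : ℝ) : ℂ) • (1 : Matrix (Finset (Orb Λ)) (Finset (Orb Λ)) ℂ) -
      ((1 / 2 : ℝ) : ℂ) • (Gp + Gm)).IsHermitian :=
    (hH0.add (isHermitian_ofReal_smul isHermitian_one _)).sub (isHermitian_ofReal_smul (hGp.add hGm) _)
  refine PosSemidef.of_dotProduct_mulVec_nonneg hE fun φ => ?_
  have him : (star φ ⬝ᵥ ((H0 + ((c : ℝ) : ℂ) • (1 : Matrix (Finset (Orb Λ)) (Finset (Orb Λ)) ℂ) -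
      ((1 / 2 : ℝ) : ℂ) • (Gp + Gm)) *ᵥ φ)).im = 0 := by
    simpa using hE.im_star_dotProduct_mulVec_self φ
  have hexp : (star φ ⬝ᵥ ((H0 + ((c : ℝ) : ℂ) • (1 : Matrix (Finset (Orb Λ)) (Finset (Orb Λ)) ℂ) -
      ((1 / 2 : ℝ) : ℂ) • (Gp + Gm)) *ᵥ φ)).re =
      (star φ ⬝ᵥ (H0 *ᵥ φ)).re + c * (star φ ⬝ᵥ φ).re -
        1 / 2 * ((star φ ⬝ᵥ (Gp *ᵥ φ)).re + (star φ ⬝ᵥ (Gm *ᵥ φ)).re) := by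
    rw [sub_mulVec, add_mulVec, smul_mulVec, smul_mulVec, add_mulVec, one_mulVec,
      dotProduct_sub, dotProduct_add, dotProduct_smul, dotProduct_smul, dotProduct_add,
      Complex.sub_re, Complex.add_re, smul_eq_mul, smul_eq_mul, Complex.re_ofReal_mul,
      Complex.re_ofReal_mul, Complex.add_re]
  have hre : 0 ≤ (star φ ⬝ᵥ ((H0 + ((c : ℝ) : ℂ) • (1 : Matrix (Finset (Orb Λ)) (Finset (Orb Λ)) ℂ) -
      ((1 / 2 : ℝ) : ℂ) • (Gp + Gm)) *ᵥ φ)).re := by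
    rw [hexp]
    by_cases hφ : φ = 0
    · simp [hφ]
    obtain ⟨c₀, hc₀, h1⟩ := exists_smul_unit hφ
    have key := re_expect_gauged_add_gauged_neg_le L M Λ e hL U θ h1
    simp only [expect] at key
    rw [re_star_smul_dotProduct_mulVec_smul, re_star_smul_dotProduct_mulVec_smul,
      re_star_smul_dotProduct_mulVec_smul] at key
    have hn : Complex.normSq c₀ * (star φ ⬝ᵥ φ).re = 1 := by
      rw [← re_star_smul_dotProduct_smul, h1, Complex.one_re]
    have hpos : 0 < Complex.normSq c₀ := Complex.normSq_pos.2 hc₀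
    have hmul : 0 ≤ Complex.normSq c₀ * ((star φ ⬝ᵥ (H0 *ᵥ φ)).re + c * (star φ ⬝ᵥ φ).re -
        1 / 2 * ((star φ ⬝ᵥ (Gp *ᵥ φ)).re + (star φ ⬝ᵥ (Gm *ᵥ φ)).re)) := by
      have hring : Complex.normSq c₀ * ((star φ ⬝ᵥ (H0 *ᵥ φ)).re + c * (star φ ⬝ᵥ φ).re -
          1 / 2 * ((star φ ⬝ᵥ (Gp *ᵥ φ)).re + (star φ ⬝ᵥ (Gm *ᵥ φ)).re)) =
          Complex.normSq c₀ * (star φ ⬝ᵥ (H0 *ᵥ φ)).re + c * (Complex.normSq c₀ * (star φ ⬝ᵥ φ).re) -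
            1 / 2 * (Complex.normSq c₀ * (star φ ⬝ᵥ (Gp *ᵥ φ)).re +
              Complex.normSq c₀ * (star φ ⬝ᵥ (Gm *ᵥ φ)).re) := by ring
      rw [hring, hn, mul_one]
      linarith
    exact (mul_nonneg_iff_of_pos_left hpos).1 hmul
  rw [Complex.nonneg_iff]
  exact ⟨hre, him.symm⟩

end OperatorBloch

/-! ### The thermal Bloch bound on every coordinate block -/

section ThermalBloch

variable (L M : ℕ) [NeZero L] [NeZero M] (Λ : Type) [LinearOrder Λ] [Fintype Λ]
  (e : Λ ≃ ZMod L × ZMod M)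

open scoped ComplexOrder in
/-- **THE THERMAL BLOCH BOUND ON THE TUBE, every coordinate block** (`L ≥ 3`, `β ≥ 0`): for every
predicate `p` on occupation sets,
`e^{-βθ²M/L} · Re Z_β(H₀|_p) ≤ Re Z_β((H₀ + Tw_θ)|_p)`, i.e. threading the flux `θ` through the long
cycle of the `L × M` tube costs block free energy at most `θ²M/L`, uniformly in `U`, `β` and `p` —
the positive-temperature twin of `tubeEnergy_le_tubeEnergy_zero_add`. Proof as in
`Literature/…/HubbardTorusFluxThermalBlochBound`: gauge into the uniform twist
(`partitionFn_toBlock_phaseGauge_conj`), Peierls–Bogoliubov twice at the midpoint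
(`log_partitionFn_sub_le_log_partitionFn_add`), time reversal (`re_partitionFn_toBlock_tubeH_neg`),
and the operator Bloch estimate compressed to the block. [cite: Watanabe2019, §2.2.3 and §4.1] -/
theorem exp_mul_re_partitionFn_toBlock_tubeH0_le (hL : 3 ≤ L) (U θ : ℝ) {β : ℝ} (hβ : 0 ≤ β)
    (p : Finset (Orb Λ) → Prop) [Fintype {a // p a}] [DecidableEq {a // p a}] :
    Real.exp (-(β * (θ ^ 2 * M / L))) * (partitionFn β ((tubeH0 L M Λ e U).toBlock p p)).re ≤
      (partitionFn β ((tubeH0 L M Λ e U + tubeTwist L M Λ e θ).toBlock p p)).re := by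
  rcases isEmpty_or_nonempty {a // p a} with hp | hp
  · simp [partitionFn, Matrix.trace]
  set H1 := tubeH0 L M Λ e U with hH1def
  set Hp := phaseGauge (fun z : Λ => Circle.exp (θ / L * ((e z).1.val : ℝ))) *
      (tubeH0 L M Λ e U + tubeTwist L M Λ e θ) *
      (phaseGauge (fun z : Λ => Circle.exp (θ / L * ((e z).1.val : ℝ))))ᴴ with hHpdef
  set Hm := phaseGauge (fun z : Λ => Circle.exp ((-θ) / L * ((e z).1.val : ℝ))) *
      (tubeH0 L M Λ e U + tubeTwist L M Λ e (-θ)) *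
      (phaseGauge (fun z : Λ => Circle.exp ((-θ) / L * ((e z).1.val : ℝ))))ᴴ with hHmdef
  set c : ℝ := θ ^ 2 * M / L with hc
  have hH1 : H1.IsHermitian := isHermitian_tubeH0 L M Λ e U
  have hHp : Hp.IsHermitian := Matrix.isHermitian_mul_mul_conjTranspose _ (isHermitian_tubeH L M Λ e U θ)
  have hHm : Hm.IsHermitian :=
    Matrix.isHermitian_mul_mul_conjTranspose _ (isHermitian_tubeH L M Λ e U (-θ))
  -- midpoint and half-difference of the two gauged blocks
  set B : Matrix {a // p a} {a // p a} ℂ :=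
    ((1 / 2 : ℝ) : ℂ) • (Hp.toBlock p p + Hm.toBlock p p) with hB
  set W : Matrix {a // p a} {a // p a} ℂ :=
    ((1 / 2 : ℝ) : ℂ) • (Hp.toBlock p p - Hm.toBlock p p) with hW
  have hBh : B.IsHermitian := isHermitian_ofReal_smul ((hHp.submatrix _).add (hHm.submatrix _)) _
  have hWh : W.IsHermitian := isHermitian_ofReal_smul ((hHp.submatrix _).sub (hHm.submatrix _)) _
  have hBW : B + W = Hp.toBlock p p := by
    ext a b
    simp only [hB, hW, Matrix.add_apply, Matrix.smul_apply, Matrix.sub_apply, smul_eq_mul]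
    push_cast
    ring
  have hBW' : B + -W = Hm.toBlock p p := by
    ext a b
    simp only [hB, hW, Matrix.add_apply, Matrix.neg_apply, Matrix.smul_apply, Matrix.sub_apply, smul_eq_mul]
    push_cast
    ring
  -- Peierls–Bogoliubov twice at the midpoint
  have hPB1 := log_partitionFn_sub_le_log_partitionFn_add hBh hWh β
  have hPB2 := log_partitionFn_sub_le_log_partitionFn_add hBh hWh.neg β
  rw [hBW] at hPB1
  rw [map_neg, Complex.neg_re, hBW'] at hPB2
  -- time reversal: the two gauged blocks have the same partition function
  have hev : (partitionFn β (Hm.toBlock p p)).re = (partitionFn β (Hp.toBlock p p)).re := by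
    rw [hHmdef, hHpdef, partitionFn_toBlock_phaseGauge_conj Λ _ β _ p,
      partitionFn_toBlock_phaseGauge_conj Λ _ β _ p]
    exact re_partitionFn_toBlock_tubeH_neg L M Λ e U θ β p
  have hlogB : Real.log (partitionFn β B).re ≤ Real.log (partitionFn β (Hp.toBlock p p)).re := by
    rw [hev] at hPB2
    linarith
  -- monotonicity of the free energy: `B ≤ H1|_p + θ²M/L`
  have hmono : Real.log (partitionFn β (H1.toBlock p p + ((c : ℝ) : ℂ) • 1)).re ≤
      Real.log (partitionFn β B).re := by
    refine log_partitionFn_le_of_posSemidef hBh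
      ((hH1.submatrix _).add (isHermitian_ofReal_smul isHermitian_one _)) hβ ?_
    have hfull := (posSemidef_tubeH0_add_sub_half_gauged L M Λ e hL U θ).submatrix
      (Subtype.val : {a // p a} → Finset (Orb Λ))
    convert hfull using 1
    ext a b
    simp only [hB, hH1def, hHpdef, hHmdef, hc, Matrix.sub_apply, Matrix.add_apply, Matrix.smul_apply,
      submatrix_apply, toBlock_apply, one_apply, Subtype.ext_iff, smul_eq_mul]
  -- scalar shift and assembly
  have hshift := log_partitionFn_add_smul_one (hH1.submatrix
    (Subtype.val : {a // p a} → Finset (Orb Λ))) β c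
  have hfin : Real.log (partitionFn β (H1.toBlock p p)).re - β * c ≤
      Real.log (partitionFn β (Hp.toBlock p p)).re := by
    have h := hmono
    rw [show (H1.toBlock p p + ((c : ℝ) : ℂ) • 1) =
      H1.submatrix Subtype.val Subtype.val + ((c : ℝ) : ℂ) • 1 from rfl, hshift] at h
    exact h.trans hlogB
  have hpos1 : 0 < (partitionFn β (H1.toBlock p p)).re := partitionFn_re_pos (hH1.submatrix _) β
  have hposp : 0 < (partitionFn β (Hp.toBlock p p)).re := partitionFn_re_pos (hHp.submatrix _) β
  have hexp := Real.exp_le_exp.mpr hfin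
  rw [Real.exp_sub, Real.exp_log hpos1, Real.exp_log hposp, div_le_iff₀ (Real.exp_pos _)] at hexp
  rw [← partitionFn_toBlock_phaseGauge_conj Λ (fun z : Λ => Circle.exp (θ / L * ((e z).1.val : ℝ))) β
      (tubeH0 L M Λ e U + tubeTwist L M Λ e θ) p, Real.exp_neg, inv_mul_le_iff₀ (Real.exp_pos _)]
  calc (partitionFn β (H1.toBlock p p)).re
      ≤ (partitionFn β (Hp.toBlock p p)).re * Real.exp (β * c) := hexp
    _ = Real.exp (β * c) * (partitionFn β (Hp.toBlock p p)).re := mul_comm _ _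

/-- **Thermal Bloch bound, logarithmic form** on a non-empty block (`L ≥ 3`, `β ≥ 0`):
`log Re Z_β(H₀|_p) - βθ²M/L ≤ log Re Z_β((H₀ + Tw_θ)|_p)`. [cite: Watanabe2019, §2.2.3 and §4.1] -/
theorem log_partitionFn_toBlock_tubeH0_sub_le (hL : 3 ≤ L) (U θ : ℝ) {β : ℝ} (hβ : 0 ≤ β)
    (p : Finset (Orb Λ) → Prop) [Fintype {a // p a}] [DecidableEq {a // p a}] [Nonempty {a // p a}] :
    Real.log (partitionFn β ((tubeH0 L M Λ e U).toBlock p p)).re - β * (θ ^ 2 * M / L) ≤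
      Real.log (partitionFn β ((tubeH0 L M Λ e U + tubeTwist L M Λ e θ).toBlock p p)).re := by
  have h := exp_mul_re_partitionFn_toBlock_tubeH0_le L M Λ e hL U θ hβ p
  have hpos0 : 0 < (partitionFn β ((tubeH0 L M Λ e U).toBlock p p)).re :=
    partitionFn_re_pos ((isHermitian_tubeH0 L M Λ e U).submatrix _) β
  have hlog := Real.log_le_log (mul_pos (Real.exp_pos _) hpos0) h
  rw [Real.log_mul (Real.exp_pos _).ne' hpos0.ne', Real.log_exp] at hlog
  linarith

/-- **Thermal Bloch bound, free-energy form** on a non-empty block (`L ≥ 3`, `β > 0`):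
`F_p(θ) ≤ F_p(0) + θ²M/L` with `F_p(θ) = -β⁻¹ log Re Z_β((H₀ + Tw_θ)|_p)` — the thermal twin of
`tubeEnergy_le_tubeEnergy_zero_add` (`E(θ) ≤ E(0) + θ²M/L`). [cite: Watanabe2019, §2.2.3 and §4.1] -/
theorem freeEnergy_toBlock_tubeH_le (hL : 3 ≤ L) (U θ : ℝ) {β : ℝ} (hβ : 0 < β)
    (p : Finset (Orb Λ) → Prop) [Fintype {a // p a}] [DecidableEq {a // p a}] [Nonempty {a // p a}] :
    -Real.log (partitionFn β ((tubeH0 L M Λ e U + tubeTwist L M Λ e θ).toBlock p p)).re / β ≤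
      -Real.log (partitionFn β ((tubeH0 L M Λ e U).toBlock p p)).re / β + θ ^ 2 * M / L := by
  have h := log_partitionFn_toBlock_tubeH0_sub_le L M Λ e hL U θ hβ.le p
  rw [neg_div, neg_div, neg_le, neg_add, neg_neg, ← sub_eq_add_neg, sub_le_iff_le_add, div_add' _ _ _ hβ.ne',
    div_le_div_iff_of_pos_right hβ]
  linarith

end ThermalBloch

/-- **THE THERMAL BLOCH BOUND, closed form** (the registered sub-goal `thermalBlochBlock` of crux
stmt-HubbardSuperconductivity-16312; all binders universally quantified): for every labelled tube
with `L ≥ 3`, every `U`, `θ`, every `β ≥ 0` and every coordinate predicate `p` on occupation sets,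
`e^{-βθ²M/L} · Re Z_β(H₀|_p) ≤ Re Z_β((H₀ + Tw_θ)|_p)`. [cite: Watanabe2019, §2.2.3 and §4.1] -/
theorem thermalBlochBlock : ∀ (L M : ℕ) [NeZero L] [NeZero M] (Λ : Type) [LinearOrder Λ] [Fintype Λ] (e : Λ ≃ ZMod L × ZMod M) (U θ β : ℝ) (p : Finset (Orb Λ) → Prop) [Fintype {a // p a}] [DecidableEq {a // p a}], 3 ≤ L → 0 ≤ β → Real.exp (-(β * (θ ^ 2 * (M : ℝ) / (L : ℝ)))) * (Matrix.partitionFn β ((tubeH0 L M Λ e U).toBlock p p)).re ≤ (Matrix.partitionFn β ((tubeH0 L M Λ e U + tubeTwist L M Λ e θ).toBlock p p)).re :=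
  fun L M _ _ Λ _ _ e U θ _β p _ _ hL hβ => exp_mul_re_partitionFn_toBlock_tubeH0_le L M Λ e hL U θ hβ p

end Summit.HubbardSuperconductivity.HubbardSuperconductivity.Theorems.WidthHaldane

end
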